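import Summits.NavierStokesRegularity.NavierStokesRegularity.Theorems.AdaptedFrequencyFrequencyRigidityWallUnconditional
import Literature.Analysis.FluidPDE.LocalTypeI
import HarnessLib

/-!
# Crux `FrequencyRigidity` (stmt-NavierStokesRegularity-2955), line `scaled-energy-split`:
# the finite-class wall

Helper file (`--supports stmt-NavierStokesRegularity-2955`; theorems only, sorry-free).  Stub
`stub_finiteClassWall` (D) of the line: Stub 2 of the line — no witness of the crux body
(classical ancient Navier–Stokes flow on `(−∞,0) × ℝ³`, global Type-I rate `C/√(−t)`, adapted
two-sided Gaussian-comparable kernel `K` at `(0,0)`, positive adapted enstrophy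
`H = ∫ ‖curl v‖² K` with constant adapted frequency `Λ ≡ Λ₀`) with FINITE Albritton–Barker
quantity `𝐈(ℝ³ × ℝ₋) < ∞` — together with leaf (C) — decaying rotated-self-similar flows
`pvAnsatz α U` (Pineau–Vicol 2026 ansatz (1.7), `‖U(y)‖ ≤ C₀/(1 + ‖y‖)`) have `𝐈 < ∞` — give
Pineau–Vicol's Conjecture 1.1 in the smooth bounded-gradient decaying class for EVERY angular
speed `α`: the profile is irrotational, `curl U ≡ 0`.

Proof (the refuter's wall `Negative.rssLiouvilleBounded_of_frequencyRigidity` of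
`Negative/RSSWall.lean`, with the crux replaced by Stub 2).  By
`MovingAdjointBernoulli.coRotatingKernelHypothesis_holds` the RSS flow `rss α U = pvAnsatz α U`
carries an adapted Gaussian-comparable kernel of CO-ROTATING self-similar form, for which the
adapted enstrophy is EXACTLY `H(t) = A/t²`, `A = ∫ ‖curl U‖² K(−1)` (`Negative.adaptedEnstrophy_rss`),
whence `Λ ≡ 2` (`Negative.freqClause_of_powerLaw`); the bounded profile gives the global Type-I
bound (`Negative.typeIBound_rss`) and leaf (C) gives `𝐈 < ∞`.  So `A > 0` would inhabit the `∃`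
negated by Stub 2; hence `A = 0`, i.e. the nonnegative continuous integrable density
`‖curl U‖² K(−1)` vanishes identically, and `K(−1) > 0`.

## References

* B. Pineau, V. Vicol, arXiv:2607.09619 (2026), §1.2 (1.7)–(1.10), Conjecture 1.1, Theorem 1.4.
  [PineauVicol2026]
* Z. Bradshaw, T.-P. Tsai, Comm. PDE 42 (2017), §5, Open Problem 5.2. [BradshawTsai2017CPDE]
* D. Albritton, T. Barker, J. Math. Fluid Mech. 21 (2019), §1 (the quantity `𝐈(ω)`).
  [AlbrittonBarker2019]
-/

noncomputable section

-- the registered stub namespace repeats the summit name `NavierStokesRegularity` (summit = problem)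
set_option linter.dupNamespace false

namespace Summit.NavierStokesRegularity.NavierStokesRegularity.Theorems.FrequencyRigidity.ScaledEnergySplit

open Literature.Analysis.FluidPDE Literature.Analysis.UnboundedOperators
open Summit.NavierStokesRegularity.NavierStokesRegularity.Theorems.FrequencyRigidity.Negative
open Summit.NavierStokesRegularity.NavierStokesRegularity.Theorems.FrequencyRigidity.MovingAdjointBernoulli
open MeasureTheory Set Filter Topology Function
open scoped Laplacian InnerProductSpace RealInnerProductSpace ContDiff

/-! ## The profile enstrophy density `‖curl U‖² K(−1)` of a bounded-gradient profile -/

/-- For a smooth profile `U` with `‖DU‖ ≤ C` and an adapted kernel `K` on `(−∞,0)` of some drift,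
the profile enstrophy density `f = ‖curl U‖² K(−1)` is nonnegative, continuous and integrable;
hence if `∫ f = 0` then `curl U ≡ 0` (`K(−1) > 0`). [folklore] -/
theorem finiteClassWall_curl_eq_zero_of_integral_eq_zero {ν : ℝ}
    {v : ℝ → EuclideanSpace ℝ (Fin 3) → EuclideanSpace ℝ (Fin 3)}
    {U : EuclideanSpace ℝ (Fin 3) → EuclideanSpace ℝ (Fin 3)}
    {K : ℝ → EuclideanSpace ℝ (Fin 3) → ℝ} {C : ℝ} (hU : ContDiff ℝ ∞ U)
    (hC : ∀ y, ‖fderiv ℝ U y‖ ≤ C) (hK : IsAdaptedBackwardKernel ν v (Iio 0) 0 0 K) :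
    0 ≤ (∫ z, ‖curl U z‖ ^ 2 * K (-1) z) ∧
      ((∫ z, ‖curl U z‖ ^ 2 * K (-1) z) = 0 → ∀ y, curl U y = 0) := by
  have hm1 : (-1:ℝ) ∈ Iio (0:ℝ) := by norm_num
  have hKpos : ∀ x, 0 < K (-1) x := hK.pos (-1) hm1
  have hKint : Integrable (K (-1)) := hK.integrable hm1
  have hKcont : Continuous (K (-1)) := (hK.contDiff_slice hm1).continuous
  have hcurl : Continuous fun z => curl U z :=
    Literature.Analysis.FluidPDE.continuous_curl (hU.of_le (by norm_cast))
  set f : E3 → ℝ := fun z => ‖curl U z‖ ^ 2 * K (-1) z with hf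
  have hf_nonneg : ∀ z, 0 ≤ f z := fun z => mul_nonneg (sq_nonneg _) (hKpos z).le
  have hf_cont : Continuous f := (hcurl.norm.pow 2).mul hKcont
  have hf_int : Integrable f := by
    refine hKint.bdd_mul (c := (‖curlCLM‖ * C) ^ 2) (hcurl.norm.pow 2).aestronglyMeasurable
      (Eventually.of_forall fun z => ?_)
    rw [Real.norm_of_nonneg (sq_nonneg _)]
    have h1 : ‖curl U z‖ ≤ ‖curlCLM‖ * C :=
      (norm_curl_le U z).trans (mul_le_mul_of_nonneg_left (hC z) (norm_nonneg curlCLM))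
    exact pow_le_pow_left₀ (norm_nonneg _) h1 2
  refine ⟨integral_nonneg hf_nonneg, fun hA0 y => ?_⟩
  have hf0 : f = fun _ => 0 := by
    have hae : f =ᵐ[volume] (fun _ => (0:ℝ)) :=
      (integral_eq_zero_iff_of_nonneg (fun z => hf_nonneg z) hf_int).1 hA0
    exact (hf_cont.ae_eq_iff_eq volume continuous_const).1 hae
  have hy : f y = 0 := by rw [hf0]
  rcases mul_eq_zero.1 hy with h | h
  · exact norm_eq_zero.1 ((pow_eq_zero_iff two_ne_zero).1 h)
  · exact absurd h (hKpos y).ne'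

/-! ## An RSS flow with a co-rotating kernel and `A > 0` inhabits the crux body -/

/-- **The witness.**  A smooth profile `U` with `‖U‖, ‖DU‖ ≤ C` whose RSS flow `rss α U` is a
classical Navier–Stokes flow (viscosity `1`) on `(−∞,0)`, an adapted Gaussian-comparable
CO-ROTATING kernel `K`, and `A = ∫ ‖curl U‖² K(−1) > 0`: then `(ν, C, Λ₀, v, q, K) =
(1, C, 2, rss α U, q, K)` satisfies the body of the crux `FrequencyRigidity` VERBATIM (the exact
power law `H = A/t²` gives `H > 0` and `Λ ≡ 2`). [cite: PineauVicol2026, §1.2 (1.7)–(1.10)] -/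
theorem finiteClassWall_cruxBody_of_pos {α C : ℝ}
    {U : EuclideanSpace ℝ (Fin 3) → EuclideanSpace ℝ (Fin 3)}
    {q : ℝ → EuclideanSpace ℝ (Fin 3) → ℝ} {K : ℝ → EuclideanSpace ℝ (Fin 3) → ℝ}
    (hU : ContDiff ℝ ∞ U) (hCb : ∀ y, ‖U y‖ ≤ C ∧ ‖fderiv ℝ U y‖ ≤ C)
    (hNS : IsClassicalNSSolutionOn (Iio 0) 1 0 (rss α U) q)
    (hK : IsAdaptedBackwardKernel 1 (rss α U) (Iio 0) 0 0 K)
    (hG : IsGaussianComparable K (Iio 0) 0 0) (hco : IsCoRotating α K)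
    (hA : 0 < ∫ z, ‖curl U z‖ ^ 2 * K (-1) z) :
    0 < (1:ℝ) ∧ IsClassicalNSSolutionOn (Set.Iio 0) 1 0 (rss α U) q ∧
      (∀ t ∈ Set.Iio (0:ℝ), ∀ x, ‖rss α U t x‖ ≤ C / Real.sqrt (-t)) ∧
      ContDiffOn ℝ 2 (Function.uncurry K) (Set.Iio (0:ℝ) ×ˢ Set.univ) ∧
      (∀ t ∈ Set.Iio (0:ℝ), ∀ x, 0 < K t x) ∧
      (∀ t ∈ Set.Iio (0:ℝ), ∀ x, timeDerivWithin (Set.Iio (0:ℝ)) K t x +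
        fderiv ℝ (K t) x (rss α U t x) + 1 * Laplacian.laplacian (K t) x = 0) ∧
      (∀ t ∈ Set.Iio (0:ℝ), ∫ x, K t x = 1) ∧
      (∀ φ : EuclideanSpace ℝ (Fin 3) → ℝ, Continuous φ → (∃ M : ℝ, ∀ x, |φ x| ≤ M) →
        Filter.Tendsto (fun t => ∫ x, φ x * K t x) (nhdsWithin (0:ℝ) (Set.Iio (0:ℝ)))
          (nhds (φ (0 : EuclideanSpace ℝ (Fin 3))))) ∧
      (∃ c₁ c₂ C₁ C₂ : ℝ, 0 < c₁ ∧ 0 < c₂ ∧ 0 < C₁ ∧ 0 < C₂ ∧ ∀ t ∈ Set.Iio (0:ℝ), ∀ x,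
        c₁ * ((0:ℝ) - t) ^ (-(3:ℝ) / 2) *
            Real.exp (-(‖x - (0 : EuclideanSpace ℝ (Fin 3))‖ ^ 2) / (c₂ * ((0:ℝ) - t))) ≤ K t x ∧
          K t x ≤ C₁ * ((0:ℝ) - t) ^ (-(3:ℝ) / 2) *
            Real.exp (-(‖x - (0 : EuclideanSpace ℝ (Fin 3))‖ ^ 2) / (C₂ * ((0:ℝ) - t)))) ∧
      (∀ H Λ : ℝ → ℝ, H = (fun t => ∫ x, ‖curl (rss α U t) x‖ ^ 2 * K t x) →
        Λ = (fun t => (0 - t) * deriv H t / H t) →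
          (∀ t ∈ Set.Iio (0:ℝ), 0 < H t) ∧ (∀ t ∈ Set.Iio (0:ℝ), Λ t = 2)) := by
  have hUd : Differentiable ℝ U := hU.differentiable (by simp)
  have hHt : ∀ t ∈ Iio (0:ℝ),
      (∫ x, ‖curl (rss α U t) x‖ ^ 2 * K t x) = (∫ z, ‖curl U z‖ ^ 2 * K (-1) z) / t ^ 2 :=
    fun t ht => adaptedEnstrophy_rss hUd hco ht
  have hTI : TypeIBound C (rss α U) := typeIBound_rss fun y => (hCb y).1
  have hCo : Comparable K := isGaussianComparable_iff_fin_three.1 hG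
  have hfreq : FreqClause (rss α U) K 2 := freqClause_of_powerLaw hA hHt
  exact ⟨one_pos, hNS, hTI, hK.contDiffOn, hK.pos, hK.adjoint_eq, hK.integral_eq_one,
    hK.tendsto_integral_mul, hCo, hfreq⟩

/-! ## The finite-class wall -/

/-- **Stub D of line `scaled-energy-split` (the finite-class wall).**  Stub 2 of the line (no
witness of the crux body with finite Albritton–Barker quantity `𝐈(ℝ³ × ℝ₋)`) and leaf (C)
(decaying rotated-self-similar flows have `𝐈 < ∞`) prove Pineau–Vicol's Conjecture 1.1 in the
smooth bounded-gradient decaying class for EVERY angular speed `α`: a smooth profile `U` with `U`,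
`DU` bounded and `‖U(y)‖ ≤ C₀/(1 + ‖y‖)` whose RSS flow `pvAnsatz α U` is a classical
Navier–Stokes flow (viscosity `1`, some pressure) on `(−∞,0)` is irrotational.  (Co-rotating
adapted kernel from `coRotatingKernelHypothesis_holds`; exact power law `H = A/t²`; `A > 0` would be
a witness, so `A = 0` and `‖curl U‖² K(−1) ≡ 0` with `K(−1) > 0`.)
[cite: PineauVicol2026, Conjecture 1.1; BradshawTsai2017CPDE, §5 OP 5.2] -/
theorem stub_finiteClassWall : (¬ ∃ (ν C Λ₀ : ℝ) (v : ℝ → EuclideanSpace ℝ (Fin 3) → EuclideanSpace ℝ (Fin 3)) (q : ℝ → EuclideanSpace ℝ (Fin 3) → ℝ) (K : ℝ → EuclideanSpace ℝ (Fin 3) → ℝ), (0 < ν ∧ Literature.Analysis.FluidPDE.IsClassicalNSSolutionOn (Set.Iio 0) ν 0 v q ∧ (∀ t ∈ Set.Iio (0:ℝ), ∀ x, ‖v t x‖ ≤ C / Real.sqrt (-t)) ∧ ContDiffOn ℝ 2 (Function.uncurry K) (Set.Iio (0:ℝ) ×ˢ Set.univ) ∧ (∀ t ∈ Set.Iio (0:ℝ),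 ∀ x, 0 < K t x) ∧ (∀ t ∈ Set.Iio (0:ℝ), ∀ x, Literature.Analysis.FluidPDE.timeDerivWithin (Set.Iio (0:ℝ)) K t x + fderiv ℝ (K t) x (v t x) + ν * Laplacian.laplacian (K t) x = 0) ∧ (∀ t ∈ Set.Iio (0:ℝ), ∫ x, K t x = 1) ∧ (∀ φ : EuclideanSpace ℝ (Fin 3) → ℝ, Continuous φ → (∃ M : ℝ, ∀ x, |φ x| ≤ M) → Filter.Tendsto (fun t => ∫ x, φ x * K t x) (nhdsWithin (0:ℝ) (Set.Iio (0:ℝ))) (nhds (φ (0 : EuclideanSpace ℝ (Fin 3))))) ∧ (∃ c₁ c₂ C₁ C₂ : ℝ, 0 < c₁ ∧ 0 < c₂ ∧ 0 < C₁ ∧ 0 < C₂ ∧ ∀ t ∈ Set.Iio (0:ℝ), ∀ x, c₁ * ((0:ℝ) - t) ^ (-(3:ℝ) / 2) * Real.exp (-(‖x - (0 : EuclideanSpace ℝ (Fin 3))‖ ^ 2) / (c₂ * ((0:ℝ) - t))) ≤ K t x ∧ K t x ≤ C₁ * ((0:ℝ) - t) ^ (-(3:ℝ) / 2) * Real.exp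 (-(‖x - (0 : EuclideanSpace ℝ (Fin 3))‖ ^ 2) / (C₂ * ((0:ℝ) - t)))) ∧ (∀ H Λ : ℝ → ℝ, H = (fun t => ∫ x, ‖Literature.Analysis.FluidPDE.curl (v t) x‖ ^ 2 * K t x) → Λ = (fun t => (0 - t) * deriv H t / H t) → (∀ t ∈ Set.Iio (0:ℝ), 0 < H t) ∧ (∀ t ∈ Set.Iio (0:ℝ), Λ t = Λ₀))) ∧ Literature.Analysis.FluidPDE.typeIBound (Set.Iio (0:ℝ) ×ˢ Set.univ) v q (fun t x => fderiv ℝ (v t) x) < ⊤) → (∀ (α C₀ : ℝ) (U : EuclideanSpace ℝ (Fin 3) → EuclideanSpace ℝ (Fin 3)) (u : ℝ → EuclideanSpace ℝ (Fin 3) → EuclideanSpace ℝ (Fin 3)) (p : ℝ → EuclideanSpace ℝ (Fin 3) → ℝ), Literature.Analysis.FluidPDE.IsClassicalNSSolutionOn (Set.Iio 0) 1 0 u p → (∀ t ∈ Set.Iio (0:ℝ), ∀ x, u t x = Literature.Analysis.FluidPDE.pvAnsatz α (fun y _ => U y) t x) → (∀ y, ‖U y‖ ≤ C₀ / (1 +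 ‖y‖)) → Literature.Analysis.FluidPDE.typeIBound (Set.Iio (0:ℝ) ×ˢ Set.univ) u p (fun t x => fderiv ℝ (u t) x) < ⊤) → ∀ (α C₀ : ℝ) (U : EuclideanSpace ℝ (Fin 3) → EuclideanSpace ℝ (Fin 3)) (q : ℝ → EuclideanSpace ℝ (Fin 3) → ℝ), ContDiff ℝ (⊤ : ℕ∞) U → (∃ C : ℝ, ∀ y, ‖U y‖ ≤ C ∧ ‖fderiv ℝ U y‖ ≤ C) → (∀ y, ‖U y‖ ≤ C₀ / (1 + ‖y‖)) → Literature.Analysis.FluidPDE.IsClassicalNSSolutionOn (Set.Iio 0) 1 0 (Literature.Analysis.FluidPDE.pvAnsatz α (fun y _ => U y)) q → ∀ y, Literature.Analysis.FluidPDE.curl U y = 0 := by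
  intro h2 hC α C₀ U q hU hbd hdec hNS
  obtain ⟨C, hCb⟩ := hbd
  -- `rss α U` is `pvAnsatz α (fun y _ => U y)` by definition
  have hNS' : IsClassicalNSSolutionOn (Iio 0) 1 0 (rss α U) q := hNS
  -- the co-rotating adapted Gaussian-comparable kernel (H(α), discharged in the tree)
  obtain ⟨K, hK, hG, hco⟩ := coRotatingKernelHypothesis_holds α U q hU ⟨C, hCb⟩ hNS'
  obtain ⟨hA_nonneg, hzero⟩ :=
    finiteClassWall_curl_eq_zero_of_integral_eq_zero hU (fun y => (hCb y).2) hK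
  refine hzero (le_antisymm (not_lt.1 fun hApos => h2 ?_) hA_nonneg)
  -- `A > 0`: the RSS flow with its kernel is a witness with finite `𝐈`
  have hI := hC α C₀ U (rss α U) q hNS' (fun _ _ _ => rfl) hdec
  exact ⟨1, C, 2, rss α U, q, K, finiteClassWall_cruxBody_of_pos hU hCb hNS' hK hG hco hApos, hI⟩

end Summit.NavierStokesRegularity.NavierStokesRegularity.Theorems.FrequencyRigidity.ScaledEnergySplit

end
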